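import Summits.QuantumFields.YangMills.Theorems.BalabanUVNodesN20KeyedRelWeightOverCut
import Literature.MathematicalPhysics.QuantumFieldTheory.Balaban1983to89.T4BadClassBooking

/-!
# BalabanUVNodes ∕ N20 (NE7b) — THE POLICY WALL OF THE N20 FACE AT THE SPINE READING OF RECORD: UNDER (EVENTUAL) SATURATION OF THE FIRST-LEVEL LARGE-FIELD
# CLASS, EVERY CUT POLICY CARRYING `RelWeightBound` AT `crOfRecord₁₃(V)At K₀ jcut sh` IS EVENTUALLY THE ZERO CUT — so at every N20-admissible dial the N19′ core
# edge is owed on ALL keyed classes for cofinitely many cutoffs (LOCATED; the kernel form of dag-n20-w3's LOCATED-1 (2), pub-ymgap INBOX l.24338)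

Cell `pub-ymgap` (HUMAN RULING D-0062 Track A; work-bound push D-0149, director-ym №197), width seat `pub-ymgap-dag-n20-w1` (gen 3) on node N20 = NE7b; key item K3⁷
`SpineGivenEndpointR13SepCoPH` = stmt-QuantumFields-20544 (`--kind proof --supports 20544 --as helper`); COUNT-NEUTRAL.  Bus: CLAIM-4 ∕ INTENT-6 (INBOX l.27213).
[III] = [Balaban1988Convergent], [LF-I] = [Balaban1989LargeFieldI], [LF-II] = [Balaban1989LargeFieldII].

WHY.  In the registered K3⁷ skeleton v3 (plan g81, 02f6f498332fdbee) the N20 conjunct of `stub_expansion13H` reads `KeyedRelWeight cr` at a spine reading pinned, on the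
live-selector line, to dag-n20-d's `crOfRecord₁₃V (jc F θ hP g₀ os) sh`; its bad class is `badClass₁₃ θ 0 g₀ (jc …) K t` («the key has a large-field region `Λ_j ≠ T_η` at
some level `1 ≤ j ≤ jc … K`»), and the large-field CUT `jc` is THE PROVER'S DIAL (plan rulings (a), l.25727 ∕ l.26233).  Three located facts frame that dial: (α) at `jc = 0`
the face is FREE (dag-n20-w2 `…N20KeyedRelWeightCutZero`, p590852); (β) over-cutting `jc … K > K₀ + K` is EXCLUDED on the live line (dag-n20-w2 g2 `…N20KeyedRelWeightOverCut`,
INTENT l.27063); (γ) dag-n20-w3's LOCATED-1 (2) (l.24338): at the (2.18) index of record «persistence» reads «a large field was CREATED at a level `≤ jc K`» (the chain is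
antitone; creation is never undone), and by a VOLUME COUNT in Bałaban's letters (poly-log suppression `e^{−C·p₀(g₁)²}` per finest block against `≍ L^{4(K₀+K)}∕(M R₁)^4`
blocks) the class «a large-field region at the FIRST level» should carry asymptotically ALL of a run's mass — a COUNT, NOT a kernel statement: it needs LOWER bounds on
large-field weights under the dressed measure, which neither print nor tree has.  THIS FILE TYPES THE KERNEL CONSEQUENCE OF (γ), the count DISPLAYED AS A HYPOTHESIS SHAPE
(`T4BadClassBooking.Saturated` of the FIRST-LEVEL class `badClass₁₃ θ K₀ g₀ (fun _ ↦ 1)`, or its EVENTUAL form), and nothing else: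
* §1 LEVEL BOOKKEEPING of the bad class of record: at step `K` it reads only `jcut K` (both runs' σ-keys sit over their own cutoff index — dag-n20-w2 g2's
  `fst_eq_of_mem_classSet₁₃`, p-landed `…N20KeyedRelWeightOverCut`, BY NAME), hence the
  AT-ONE-CUTOFF monotonicity `badClass₁₃_mono_at` (dag-n20-w3's `badKeysSigma_mono_policy` is the global-policy form), `badClass₁₃_eq_empty_of_apply_eq_zero`, and the
  first-level class: run A's key lies in it iff `s.Λ 1 ≠ T_η` — a large-field region at the FIRST renormalisation step ([III] (2.18) p.257; [LF-II] (1.80) p.384).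
* §2 THE WALL AT THE CARRIERS OF RECORD, any policy `jcut`: a `RelWeightBound` at `badClass₁₃ … jcut` pays `c ≤ W K` at every step `K` with `1 ≤ jcut K` where the first-level
  class holds the fraction `c` (`le_weight_of_levelOne_fraction`); hence (i) `Saturated` first-level class + `∀ K, 1 ≤ jcut K` ⇒ NO witness `W` (`T4BadClassBooking.
  not_relWeightBound_of_subset_saturated` BY NAME) and (ii) ★★ EVENTUAL saturation + ANY witness ⇒ `∀ᶠ K in atTop, jcut K = 0` (`Filter.Eventually.and_frequently` +
  `T4ShellCount.not_summable_of_frequently_le`): the `Summable W` field of NE7b's binder, not its `W < 1` field, is the wall.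
* §3 THE JOINT CONTENT: an eventually-zero policy empties the bad class cofinitely, so any `NE7.Core … (badClass₁₃ … jcut) P Q δ` (N19′'s `hedge` ∕ `KeyedCoreEdgeHolderD4`
  shape at the same reading) delivers the two-sided bound on EVERY keyed class for cofinitely many `K` — NE7 PROPER ON ALL HISTORIES, asymptotically, whatever the dial.
* §4 the same at the reading of record `crOfRecord₁₃At` ∕ `crOfRecord₁₃VAt` (canonical `W`; fields by `rfl`); §5 the K3⁷ v3 SHAPES on the live line — there run A's total
  class mass is POSITIVE by E1 (`schemeZ_eq_sum_classSet_weightA`) + `schemeZ_pos_datumOfRecord₁₃CoPH`, so saturation is the bare fraction inequality; ★★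
  `eventually_cut_eq_zero_of_keyedRelWeight_pinnedAtLive`: at a live tuple whose first-level fraction is eventually `≥ c > 0`, the cut READING of ANY stub-2 witness is
  eventually `0` there; §6 converse bookkeeping: at an eventually-zero policy the N20 face is a FINITE-CUTOFF statement (a witness of finite support).
Cited BY NAME, nothing re-typed: dag-n20-d `Node00/TwoRunSitePersistence` + `Thm/…SpineReadingOfRecord13CoPH(V)` (p583644 ∕ p587226 ∕ p590105), dag-n20-w2 `…CutZero` ∕
`…N21KeyedShellWeightShellZero` (`weightA₁₃_nonneg ∕ weightB₁₃_nonneg`, p590852 ∕ p593923) ∕ g2 `…N20KeyedRelWeightOverCut` (`fst_eq_of_mem_classSet₁₃`), dag-n20-w3 `…N20CoreEdgeAtPersistentKeys` §3b (p585901), this seat's g0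
`…N20KeyedRelWeightSocketAtRecord13CoPH` §1 (p588277), `…N20AtRecord13CoPH.schemeZ_pos_datumOfRecord₁₃CoPH`, `T4WeightBudget` :117, `T4BadClassBooking` §1–§2.

HONEST FRAMING.  LOCATED, count-neutral kernel bookkeeping ([folklore] real analysis over the tree's finite-sum shapes BY NAME); proves NO estimate.  The saturation of the
first-level class is a DISPLAYED HYPOTHESIS SHAPE — dag-n20-w3's count in Bałaban's letters, NOT PRINTED, NOT proved, NOT asserted for Bałaban's weights (A6: every theorem
below is an implication whose antecedent is inhabited for no family today; what it locates is the cell's OWN bookkeeping: at the (2.18) index of record the N20 face's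
summability content is nil at every admissible dial unless the index is extended by the 𝐑-status of components, LOCATED-1 (3)(ii)).  Nothing of Bałaban's is asserted;
NE7 ∕ NE7b ∕ NE7c NOT PRINTED for `d = 4`, NOT proved; N19 ∕ N20 ∕ N21 ∕ N27 NOT discharged; K3⁷ NOT closed; counts unmoved (typed 28∕28 · discharged 5∕27); no count claim.
One finite `𝕋⁴_{L^K}` programme at fixed `ε = L^{−K}` along `K → ∞`, Bałaban AS PRINTED; the YM mass gap (Clay) is NOT proved by any of this — R4 closes the conditional
finite-𝕋⁴ rung `BalabanLadder.UV` only; NOT ℝ⁴, NOT OS.  No `def`, no `instance`, no `notation`, no `sorry`.  Sources (bookkeeping): [III] (2.1) p.254, (2.18) p.257; [LF-I]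
(0.2)–(0.4) p.176, p.177; [LF-II] Thm 1 + (0.1) pp.355–356, (1.79)–(1.80) pp.383–384, (1.85)–(1.89) pp.386–387; [King1986] (3.10)–(3.11) p.656.
-/

noncomputable section

open scoped BigOperators
open _root_.Filter _root_.Topology

namespace Summit.QuantumFields.YangMills.BalabanUVNodes.N20KeyedRelWeightPolicyWall

open Literature.MathematicalPhysics.QuantumFieldTheory.Balaban1983to89 Literature.MathematicalPhysics.QuantumFieldTheory.Balaban1983to89.Node00
open T4Continuum Summit.QuantumFields.BalabanUV.T4Continuum.Spine
open T4WeightBudget (RelWeightBound)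
open T4BadClassBooking (Saturated le_weight_of_fraction_le le_weight_of_fraction_le_right relWeightBound_mono not_relWeightBound_of_subset_saturated
  not_relWeightBound_of_saturated_right)
open T4ShellCount (not_summable_of_frequently_le)
open YMDAG.UVSplit
open Summit.QuantumFields.YangMills.BalabanUVNodes.N20KeyedRelWeightCutZero (badClass₁₃_cutZero)
open Summit.QuantumFields.YangMills.BalabanUVNodes.N21KeyedShellWeightShellZero (weightA₁₃_nonneg weightB₁₃_nonneg zeta_nonneg_of_provisos₁₃CoPH)
open Summit.QuantumFields.YangMills.BalabanUVNodes.N20KeyedRelWeightSocketAtRecord13CoPH (keyA₁₃_mem_classSet₁₃)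
open Summit.QuantumFields.YangMills.BalabanUVNodes.N20KeyedRelWeightOverCut (fst_eq_of_mem_classSet₁₃)
open Summit.QuantumFields.YangMills.Theorems.N20AtRecord13 (schemeZ_pos_datumOfRecord₁₃CoPH)

variable {F : T4Family} {N : ℕ} [NeZero N]

/-! ## §1  Level bookkeeping of the bad class of record: at step `K` only `jcut K` is read; the first-level class -/

section Level

/-- **«AN OLD LARGE-FIELD REGION BELOW LEVEL 1» ⟺ «A LARGE-FIELD REGION AT THE FIRST LEVEL»**: `KeyOldLargeField 1 x ↔ x.2 1 ≠ T_η` (any key space). [bookkeeping] -/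
theorem keyOldLargeField_one_iff {α : Type*} (x : (ℕ → Set α) × (ℕ → Set α)) : KeyOldLargeField 1 x ↔ x.2 1 ≠ Set.univ := by
  constructor
  · rintro ⟨j, h1, hj, hne⟩
    obtain rfl : j = 1 := le_antisymm hj h1
    exact hne
  · exact fun h => ⟨1, le_rfl, le_rfl, h⟩

variable (θ : Stage13HParams F N) (K₀ : ℕ) (g₀ : ℕ → ℝ)

/-- **MEMBERSHIP IN THE BAD CLASS OF RECORD AT STEP `K` READS THE POLICY AT `K` ONLY**: `x ∈ badClass₁₃ θ K₀ g₀ jcut K t ↔ x ∈ classSet₁₃ θ K₀ g₀ K ∧ KeyOldLargeField (jcut K) x.2`.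
[bookkeeping] -/
theorem mem_badClass₁₃_iff (jcut : ℕ → ℕ) (K : ℕ) (t : ℝ) (x : Σ K, SiteSeqKey F (K₀ + K)) :
    x ∈ badClass₁₃ θ K₀ g₀ jcut K t ↔ x ∈ classSet₁₃ θ K₀ g₀ K ∧ KeyOldLargeField (jcut K) x.2 := by
  unfold badClass₁₃
  rw [mem_badKeysSigma_iff]
  constructor
  · rintro ⟨hx, h⟩
    exact ⟨hx, fst_eq_of_mem_classSet₁₃ θ K₀ g₀ K hx ▸ h⟩
  · rintro ⟨hx, h⟩
    exact ⟨hx, (fst_eq_of_mem_classSet₁₃ θ K₀ g₀ K hx).symm ▸ h⟩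

/-- **AT-ONE-CUTOFF MONOTONICITY**: `jcut K ≤ jcut' K ⇒ badClass₁₃ … jcut K t ⊆ badClass₁₃ … jcut' K t` (dag-n20-w3's `badKeysSigma_mono_policy` needs the comparison at every
cutoff; at the reading of record the comparison AT `K` suffices). [bookkeeping] -/
theorem badClass₁₃_mono_at {jcut jcut' : ℕ → ℕ} {K : ℕ} (h : jcut K ≤ jcut' K) (t : ℝ) :
    badClass₁₃ θ K₀ g₀ jcut K t ⊆ badClass₁₃ θ K₀ g₀ jcut' K t := by
  intro x hx
  rw [mem_badClass₁₃_iff] at hx ⊢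
  exact ⟨hx.1, hx.2.mono h⟩

/-- Two policies agreeing at `K` have the same bad class at step `K`. [bookkeeping] -/
theorem badClass₁₃_congr_at {jcut jcut' : ℕ → ℕ} {K : ℕ} (h : jcut K = jcut' K) (t : ℝ) :
    badClass₁₃ θ K₀ g₀ jcut K t = badClass₁₃ θ K₀ g₀ jcut' K t :=
  Finset.Subset.antisymm (badClass₁₃_mono_at θ K₀ g₀ h.le t) (badClass₁₃_mono_at θ K₀ g₀ h.ge t)

/-- **A POLICY VANISHING AT `K` HAS AN EMPTY BAD CLASS AT STEP `K`** (dag-n20-w2's `badClass₁₃_cutZero` at the zero policy, transported by `badClass₁₃_congr_at`). [bookkeeping] -/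
theorem badClass₁₃_eq_empty_of_apply_eq_zero {jcut : ℕ → ℕ} {K : ℕ} (h : jcut K = 0) (t : ℝ) : badClass₁₃ θ K₀ g₀ jcut K t = ∅ := by
  rw [badClass₁₃_congr_at θ K₀ g₀ (jcut' := fun _ => 0) h t]
  exact badClass₁₃_cutZero F θ K₀ g₀ K t

/-- **THE FIRST-LEVEL CLASS** `badClass₁₃ θ K₀ g₀ (fun _ ↦ 1)`: a key of the class set lies in it iff its small-field sequence is not the whole torus AT LEVEL 1.
[bookkeeping] -/
theorem mem_badClass₁₃_levelOne_iff (K : ℕ) (t : ℝ) (x : Σ K, SiteSeqKey F (K₀ + K)) :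
    x ∈ badClass₁₃ θ K₀ g₀ (fun _ => 1) K t ↔ x ∈ classSet₁₃ θ K₀ g₀ K ∧ x.2.2 1 ≠ Set.univ := by
  rw [mem_badClass₁₃_iff, keyOldLargeField_one_iff]

/-- **RUN A: the key of a (2.18) history lies in the first-level class iff `s.Λ 1 ≠ T_η`** — a large-field region created at the FIRST renormalisation step of the run
(cutoff `K₀ + K`, finest lattice). [bookkeeping] -/
theorem keyA₁₃_mem_badClass₁₃_levelOne_iff (K : ℕ) (t : ℝ) (s : SeqOfRecord F θ.ν θ.τ9.M (histA₁₃ θ K₀ g₀ K) (K₀ + K) (K₀ + K)) :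
    keyA₁₃ θ K₀ g₀ K s ∈ badClass₁₃ θ K₀ g₀ (fun _ => 1) K t ↔ s.Λ 1 ≠ Set.univ := by
  rw [mem_badClass₁₃_levelOne_iff]
  exact ⟨fun h => h.2, fun h => ⟨keyA₁₃_mem_classSet₁₃ θ K₀ g₀ K s, h⟩⟩

/-- **THE FIRST-LEVEL CLASS SITS INSIDE THE BAD CLASS OF EVERY POLICY CUTTING AT LEAST ONE LEVEL AT `K`**. [bookkeeping] -/
theorem badClass₁₃_levelOne_subset_of_one_le {jcut : ℕ → ℕ} {K : ℕ} (h : 1 ≤ jcut K) (t : ℝ) :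
    badClass₁₃ θ K₀ g₀ (fun _ => 1) K t ⊆ badClass₁₃ θ K₀ g₀ jcut K t :=
  badClass₁₃_mono_at θ K₀ g₀ (jcut := fun _ => 1) h t

end Level

/-! ## §2  The wall at the carriers of record, any policy: what a `RelWeightBound` pays where the first-level class holds a fraction of the mass -/

section Wall

variable (θ : Stage13HParams F N) (hP : θ.Provisos₁₃CoPH F N) (K₀ : ℕ) (g₀ : ℕ → ℝ) (os : List (ULoop F))

/-- **FRACTION EXTRACTION AT A CUTTING STEP, run A**: a `RelWeightBound` at the policy-`jcut` class, a step `K` with `1 ≤ jcut K`, a source `|t| ≤ 1` with positive run-A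
mass of which the FIRST-LEVEL class holds the fraction `c` ⇒ `c ≤ W K` (the keyed weights are `≥ 0`, `weightA₁₃_nonneg`; `T4BadClassBooking.le_weight_of_fraction_le`).
[bookkeeping] -/
theorem le_weight_of_levelOne_fraction {jcut : ℕ → ℕ} {W : ℕ → ℝ}
    (hW : RelWeightBound 1 (classSet₁₃ θ K₀ g₀) (weightA₁₃ θ hP K₀ g₀ os) (weightB₁₃ θ hP K₀ g₀ os) (badClass₁₃ θ K₀ g₀ jcut) W)
    {K : ℕ} (hK : 1 ≤ jcut K) {t c : ℝ} (ht : |t| ≤ 1) (hpos : 0 < ∑ x ∈ classSet₁₃ θ K₀ g₀ K, weightA₁₃ θ hP K₀ g₀ os K t x)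
    (hc : c * ∑ x ∈ classSet₁₃ θ K₀ g₀ K, weightA₁₃ θ hP K₀ g₀ os K t x ≤ ∑ x ∈ badClass₁₃ θ K₀ g₀ (fun _ => 1) K t, weightA₁₃ θ hP K₀ g₀ os K t x) :
    c ≤ W K :=
  le_weight_of_fraction_le hW ht hpos
    (hc.trans (Finset.sum_le_sum_of_subset_of_nonneg (badClass₁₃_levelOne_subset_of_one_le θ K₀ g₀ hK t)
      fun x _ _ => weightA₁₃_nonneg F θ hP K₀ g₀ os K t x))

/-- **FRACTION EXTRACTION AT A CUTTING STEP, run B** (`weightB₁₃_nonneg`; `le_weight_of_fraction_le_right`). [bookkeeping] -/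
theorem le_weight_of_levelOne_fraction_right {jcut : ℕ → ℕ} {W : ℕ → ℝ}
    (hW : RelWeightBound 1 (classSet₁₃ θ K₀ g₀) (weightA₁₃ θ hP K₀ g₀ os) (weightB₁₃ θ hP K₀ g₀ os) (badClass₁₃ θ K₀ g₀ jcut) W)
    {K : ℕ} (hK : 1 ≤ jcut K) {t c : ℝ} (ht : |t| ≤ 1) (hpos : 0 < ∑ x ∈ classSet₁₃ θ K₀ g₀ K, weightB₁₃ θ hP K₀ g₀ os K t x)
    (hc : c * ∑ x ∈ classSet₁₃ θ K₀ g₀ K, weightB₁₃ θ hP K₀ g₀ os K t x ≤ ∑ x ∈ badClass₁₃ θ K₀ g₀ (fun _ => 1) K t, weightB₁₃ θ hP K₀ g₀ os K t x) :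
    c ≤ W K :=
  le_weight_of_fraction_le_right hW ht hpos
    (hc.trans (Finset.sum_le_sum_of_subset_of_nonneg (badClass₁₃_levelOne_subset_of_one_le θ K₀ g₀ hK t)
      fun x _ _ => weightB₁₃_nonneg F θ hP K₀ g₀ os K t x))

/-- ★ **THE WALL (i), run A: A SATURATED FIRST-LEVEL CLASS ADMITS NO N20 WITNESS AT ANY POLICY CUTTING AT LEAST ONE LEVEL EVERYWHERE** — for NO weight sequence `W`
(`T4BadClassBooking.not_relWeightBound_of_subset_saturated` BY NAME at the sub-class `badClass₁₃ … (fun _ ↦ 1) ⊆ badClass₁₃ … jcut`).  The hypothesis `Saturated …` is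
dag-n20-w3's count DISPLAYED, not proved. [bookkeeping] -/
theorem not_relWeightBound_carriers₁₃_of_levelOne_saturated {c : ℝ} (hc : 0 < c)
    (hsat : Saturated 1 (classSet₁₃ θ K₀ g₀) (weightA₁₃ θ hP K₀ g₀ os) (badClass₁₃ θ K₀ g₀ (fun _ => 1)) c)
    {jcut : ℕ → ℕ} (hj : ∀ K, 1 ≤ jcut K) (W : ℕ → ℝ) :
    ¬ RelWeightBound 1 (classSet₁₃ θ K₀ g₀) (weightA₁₃ θ hP K₀ g₀ os) (weightB₁₃ θ hP K₀ g₀ os) (badClass₁₃ θ K₀ g₀ jcut) W :=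
  not_relWeightBound_of_subset_saturated (fun K t _ => badClass₁₃_levelOne_subset_of_one_le θ K₀ g₀ (hj K) t)
    (fun K t _ x _ => weightA₁₃_nonneg F θ hP K₀ g₀ os K t x) (fun K t _ x _ => weightB₁₃_nonneg F θ hP K₀ g₀ os K t x) hc hsat W

/-- ★ **THE WALL (i), run B.** [bookkeeping] -/
theorem not_relWeightBound_carriers₁₃_of_levelOne_saturated_right {c : ℝ} (hc : 0 < c)
    (hsat : Saturated 1 (classSet₁₃ θ K₀ g₀) (weightB₁₃ θ hP K₀ g₀ os) (badClass₁₃ θ K₀ g₀ (fun _ => 1)) c)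
    {jcut : ℕ → ℕ} (hj : ∀ K, 1 ≤ jcut K) (W : ℕ → ℝ) :
    ¬ RelWeightBound 1 (classSet₁₃ θ K₀ g₀) (weightA₁₃ θ hP K₀ g₀ os) (weightB₁₃ θ hP K₀ g₀ os) (badClass₁₃ θ K₀ g₀ jcut) W :=
  fun hW => not_relWeightBound_of_saturated_right hc hsat W
    (relWeightBound_mono hW (fun K t _ => badClass₁₃_levelOne_subset_of_one_le θ K₀ g₀ (hj K) t)
      (fun K t _ x _ => weightA₁₃_nonneg F θ hP K₀ g₀ os K t x) (fun K t _ x _ => weightB₁₃_nonneg F θ hP K₀ g₀ os K t x))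

/-- ★★ **THE WALL (ii), run A: UNDER EVENTUAL FIRST-LEVEL SATURATION EVERY N20-ADMISSIBLE POLICY IS EVENTUALLY THE ZERO CUT.**  If from some cutoff on the first-level
class holds the fraction `c > 0` of run A's mass at some admissible source (DISPLAYED; dag-n20-w3's count says `c → 1`), then ANY `RelWeightBound` at the policy-`jcut`
class of record forces `jcut K = 0` for cofinitely many `K`: a cutting step in the saturated range pays `c ≤ W K`, and `c ≤ W K` infinitely often contradicts `Summable W`
(`T4ShellCount.not_summable_of_frequently_le`).  The `Summable W` field of NE7b's binder is the wall, not `W < 1`. [bookkeeping] -/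
theorem eventually_policy_eq_zero_of_relWeightBound_carriers₁₃ {c : ℝ} (hc : 0 < c)
    (hsat : ∀ᶠ K in atTop, ∃ t : ℝ, |t| ≤ 1 ∧ 0 < ∑ x ∈ classSet₁₃ θ K₀ g₀ K, weightA₁₃ θ hP K₀ g₀ os K t x ∧
      c * ∑ x ∈ classSet₁₃ θ K₀ g₀ K, weightA₁₃ θ hP K₀ g₀ os K t x ≤ ∑ x ∈ badClass₁₃ θ K₀ g₀ (fun _ => 1) K t, weightA₁₃ θ hP K₀ g₀ os K t x)
    {jcut : ℕ → ℕ} {W : ℕ → ℝ}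
    (hW : RelWeightBound 1 (classSet₁₃ θ K₀ g₀) (weightA₁₃ θ hP K₀ g₀ os) (weightB₁₃ θ hP K₀ g₀ os) (badClass₁₃ θ K₀ g₀ jcut) W) :
    ∀ᶠ K in atTop, jcut K = 0 := by
  by_contra h
  have hfr : ∃ᶠ K in atTop, jcut K ≠ 0 := Filter.not_eventually.1 h
  refine not_summable_of_frequently_le hc ((hsat.and_frequently hfr).mono fun K hK => ?_) hW.summable
  obtain ⟨⟨t, ht, hpos, hle⟩, hK⟩ := hK
  exact le_weight_of_levelOne_fraction θ hP K₀ g₀ os hW (Nat.one_le_iff_ne_zero.2 hK) ht hpos hle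

end Wall

/-! ## §3  The joint content: an eventually-zero policy makes the core edge a statement on ALL keyed classes, cofinitely -/

section Joint

variable (θ : Stage13HParams F N) (hP : θ.Provisos₁₃CoPH F N) (K₀ : ℕ) (g₀ : ℕ → ℝ) (os : List (ULoop F))

/-- **AN EVENTUALLY-ZERO POLICY EXCUSES NO CLASS COFINITELY**: `NE7.Core l₀ vol (classSet₁₃ …) (badClass₁₃ … jcut) P Q δ` with `∀ᶠ K, jcut K = 0` gives, for cofinitely
many `K`, ONE constant `c` with `e^{c − vol·δ K}·P ≤ Q ≤ e^{c + vol·δ K}·P` on EVERY key of the class set, `|t| ≤ l₀` — the N19′ face then compares the two runs on all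
(2.18) histories, old large fields included (reading (i) of LOCATED-1 (3)).  Any decidability instance on the σ-keys. [bookkeeping] -/
theorem core_allClasses_eventually_of_policy_eventually_zero [DecidableEq (Σ K, SiteSeqKey F (K₀ + K))] {l₀ vol : ℝ} {jcut : ℕ → ℕ}
    {P Q : ℕ → ℝ → (Σ K, SiteSeqKey F (K₀ + K)) → ℝ} {δ : ℕ → ℝ}
    (hcore : NE7.Core l₀ vol (classSet₁₃ θ K₀ g₀) (badClass₁₃ θ K₀ g₀ jcut) P Q δ) (hev : ∀ᶠ K in atTop, jcut K = 0) :
    ∀ᶠ K in atTop, ∃ c : ℝ, ∀ t : ℝ, |t| ≤ l₀ → ∀ x ∈ classSet₁₃ θ K₀ g₀ K,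
      Real.exp (c - vol * δ K) * P K t x ≤ Q K t x ∧ Q K t x ≤ Real.exp (c + vol * δ K) * P K t x :=
  hev.mono fun K hK => by
    obtain ⟨c, hc⟩ := hcore K
    refine ⟨c, fun t ht x hx => hc t ht x ?_⟩
    rw [Finset.mem_sdiff, badClass₁₃_eq_empty_of_apply_eq_zero θ K₀ g₀ hK t]
    exact ⟨hx, Finset.notMem_empty x⟩

/-- ★★ **UNDER EVENTUAL FIRST-LEVEL SATURATION THE DIAL BUYS NOTHING ASYMPTOTICALLY**: at ANY policy `jcut`, the N20 face `RelWeightBound … (badClass₁₃ … jcut) W` TOGETHER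
WITH the N19′ core `NE7.Core … (badClass₁₃ … jcut) P Q δ` at the same class forces the two-sided core bound on EVERY keyed class for cofinitely many cutoffs — NE7 PROPER on
all histories in the limit, whatever classes the policy excused at finite `K` (§2 (ii) + `core_allClasses_eventually_of_policy_eventually_zero`). [bookkeeping] -/
theorem core_allClasses_eventually_of_relWeightBound_of_levelOne_saturated [DecidableEq (Σ K, SiteSeqKey F (K₀ + K))] {c : ℝ} (hc : 0 < c)
    (hsat : ∀ᶠ K in atTop, ∃ t : ℝ, |t| ≤ 1 ∧ 0 < ∑ x ∈ classSet₁₃ θ K₀ g₀ K, weightA₁₃ θ hP K₀ g₀ os K t x ∧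
      c * ∑ x ∈ classSet₁₃ θ K₀ g₀ K, weightA₁₃ θ hP K₀ g₀ os K t x ≤ ∑ x ∈ badClass₁₃ θ K₀ g₀ (fun _ => 1) K t, weightA₁₃ θ hP K₀ g₀ os K t x)
    {jcut : ℕ → ℕ} {W : ℕ → ℝ} {l₀ vol : ℝ} {P Q : ℕ → ℝ → (Σ K, SiteSeqKey F (K₀ + K)) → ℝ} {δ : ℕ → ℝ}
    (hW : RelWeightBound 1 (classSet₁₃ θ K₀ g₀) (weightA₁₃ θ hP K₀ g₀ os) (weightB₁₃ θ hP K₀ g₀ os) (badClass₁₃ θ K₀ g₀ jcut) W)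
    (hcore : NE7.Core l₀ vol (classSet₁₃ θ K₀ g₀) (badClass₁₃ θ K₀ g₀ jcut) P Q δ) :
    ∀ᶠ K in atTop, ∃ c : ℝ, ∀ t : ℝ, |t| ≤ l₀ → ∀ x ∈ classSet₁₃ θ K₀ g₀ K,
      Real.exp (c - vol * δ K) * P K t x ≤ Q K t x ∧ Q K t x ≤ Real.exp (c + vol * δ K) * P K t x :=
  core_allClasses_eventually_of_policy_eventually_zero θ K₀ g₀ hcore (eventually_policy_eq_zero_of_relWeightBound_carriers₁₃ θ hP K₀ g₀ os hc hsat hW)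

end Joint

/-! ## §4  At the reading of record (canonical `W`; both volume letters): the N20 face ⇒ the policy is eventually zero -/

section Record

variable (K₀ : ℕ) (jcut : ℕ → ℕ) (θ : Stage13HParams F N) (hP : θ.Provisos₁₃CoPH F N) (g₀ : ℕ → ℝ) (os : List (ULoop F))

/-- ★★ **AT `crOfRecord₁₃At K₀ jcut sh`**: under eventual first-level saturation of run A's mass at the tuple, the `RelWeightBound` face AT THE READING (its canonical `W = wInf …`,
its `Bad = badClass₁₃ … jcut` — dag-n20-d's dictionary, `rfl`) forces `∀ᶠ K, jcut K = 0`; ANY shell split `sh`. [bookkeeping] -/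
theorem eventually_policy_eq_zero_of_relWeightBound_crOfRecord₁₃At (sh : ShellSplit₁₃CoPH N K₀) {c : ℝ} (hc : 0 < c)
    (hsat : ∀ᶠ K in atTop, ∃ t : ℝ, |t| ≤ 1 ∧ 0 < ∑ x ∈ classSet₁₃ θ K₀ g₀ K, weightA₁₃ θ hP K₀ g₀ os K t x ∧
      c * ∑ x ∈ classSet₁₃ θ K₀ g₀ K, weightA₁₃ θ hP K₀ g₀ os K t x ≤ ∑ x ∈ badClass₁₃ θ K₀ g₀ (fun _ => 1) K t, weightA₁₃ θ hP K₀ g₀ os K t x)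
    (h : RelWeightBound (crOfRecord₁₃At K₀ jcut sh F θ hP g₀ os).l₀ (crOfRecord₁₃At K₀ jcut sh F θ hP g₀ os).T (crOfRecord₁₃At K₀ jcut sh F θ hP g₀ os).A
      (crOfRecord₁₃At K₀ jcut sh F θ hP g₀ os).B (crOfRecord₁₃At K₀ jcut sh F θ hP g₀ os).Bad (crOfRecord₁₃At K₀ jcut sh F θ hP g₀ os).W) :
    ∀ᶠ K in atTop, jcut K = 0 :=
  eventually_policy_eq_zero_of_relWeightBound_carriers₁₃ θ hP K₀ g₀ os hc hsat h

/-- ★★ **AT THE PHYSICAL-VOLUME READING `crOfRecord₁₃VAt K₀ jcut sh`** (K3⁷ v3's pin; the N20 face does not read `vol`). [bookkeeping] -/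
theorem eventually_policy_eq_zero_of_relWeightBound_crOfRecord₁₃VAt (sh : ShellSplit₁₃CoPH N K₀) {c : ℝ} (hc : 0 < c)
    (hsat : ∀ᶠ K in atTop, ∃ t : ℝ, |t| ≤ 1 ∧ 0 < ∑ x ∈ classSet₁₃ θ K₀ g₀ K, weightA₁₃ θ hP K₀ g₀ os K t x ∧
      c * ∑ x ∈ classSet₁₃ θ K₀ g₀ K, weightA₁₃ θ hP K₀ g₀ os K t x ≤ ∑ x ∈ badClass₁₃ θ K₀ g₀ (fun _ => 1) K t, weightA₁₃ θ hP K₀ g₀ os K t x)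
    (h : RelWeightBound (crOfRecord₁₃VAt K₀ jcut sh F θ hP g₀ os).l₀ (crOfRecord₁₃VAt K₀ jcut sh F θ hP g₀ os).T (crOfRecord₁₃VAt K₀ jcut sh F θ hP g₀ os).A
      (crOfRecord₁₃VAt K₀ jcut sh F θ hP g₀ os).B (crOfRecord₁₃VAt K₀ jcut sh F θ hP g₀ os).Bad (crOfRecord₁₃VAt K₀ jcut sh F θ hP g₀ os).W) :
    ∀ᶠ K in atTop, jcut K = 0 :=
  eventually_policy_eq_zero_of_relWeightBound_carriers₁₃ θ hP K₀ g₀ os hc hsat h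

/-- … and then the reading's OWN core face (N19′ at `crOfRecord₁₃VAt`, shell-corrected weights, the reading's rate `δ`) holds on EVERY keyed class cofinitely. [bookkeeping] -/
theorem core_allClasses_eventually_crOfRecord₁₃VAt (sh : ShellSplit₁₃CoPH N K₀) {c : ℝ} (hc : 0 < c)
    (hsat : ∀ᶠ K in atTop, ∃ t : ℝ, |t| ≤ 1 ∧ 0 < ∑ x ∈ classSet₁₃ θ K₀ g₀ K, weightA₁₃ θ hP K₀ g₀ os K t x ∧
      c * ∑ x ∈ classSet₁₃ θ K₀ g₀ K, weightA₁₃ θ hP K₀ g₀ os K t x ≤ ∑ x ∈ badClass₁₃ θ K₀ g₀ (fun _ => 1) K t, weightA₁₃ θ hP K₀ g₀ os K t x)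
    (h20 : RelWeightBound (crOfRecord₁₃VAt K₀ jcut sh F θ hP g₀ os).l₀ (crOfRecord₁₃VAt K₀ jcut sh F θ hP g₀ os).T (crOfRecord₁₃VAt K₀ jcut sh F θ hP g₀ os).A
      (crOfRecord₁₃VAt K₀ jcut sh F θ hP g₀ os).B (crOfRecord₁₃VAt K₀ jcut sh F θ hP g₀ os).Bad (crOfRecord₁₃VAt K₀ jcut sh F θ hP g₀ os).W)
    (h19 : letI := (crOfRecord₁₃VAt K₀ jcut sh F θ hP g₀ os).dec
      NE7.Core (crOfRecord₁₃VAt K₀ jcut sh F θ hP g₀ os).l₀ (crOfRecord₁₃VAt K₀ jcut sh F θ hP g₀ os).vol (crOfRecord₁₃VAt K₀ jcut sh F θ hP g₀ os).T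
        (crOfRecord₁₃VAt K₀ jcut sh F θ hP g₀ os).Bad
        (fun K t τ => (crOfRecord₁₃VAt K₀ jcut sh F θ hP g₀ os).A K t τ - (crOfRecord₁₃VAt K₀ jcut sh F θ hP g₀ os).shA K t τ)
        (fun K t τ => (crOfRecord₁₃VAt K₀ jcut sh F θ hP g₀ os).B K t τ - (crOfRecord₁₃VAt K₀ jcut sh F θ hP g₀ os).shB K t τ)
        (crOfRecord₁₃VAt K₀ jcut sh F θ hP g₀ os).δ) :
    ∀ᶠ K in atTop, ∃ c : ℝ, ∀ t : ℝ, |t| ≤ 1 → ∀ x ∈ classSet₁₃ θ K₀ g₀ K,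
      Real.exp (c - (F.side : ℝ) ^ 4 * (crOfRecord₁₃VAt K₀ jcut sh F θ hP g₀ os).δ K) * (weightA₁₃ θ hP K₀ g₀ os K t x - (sh F θ hP g₀ os).1 K t x)
          ≤ weightB₁₃ θ hP K₀ g₀ os K t x - (sh F θ hP g₀ os).2 K t x ∧
        weightB₁₃ θ hP K₀ g₀ os K t x - (sh F θ hP g₀ os).2 K t x
          ≤ Real.exp (c + (F.side : ℝ) ^ 4 * (crOfRecord₁₃VAt K₀ jcut sh F θ hP g₀ os).δ K) * (weightA₁₃ θ hP K₀ g₀ os K t x - (sh F θ hP g₀ os).1 K t x) := by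
  letI : DecidableEq (Σ K, SiteSeqKey F (K₀ + K)) := (crOfRecord₁₃VAt K₀ jcut sh F θ hP g₀ os).dec
  exact core_allClasses_eventually_of_policy_eventually_zero θ K₀ g₀ h19
    (eventually_policy_eq_zero_of_relWeightBound_carriers₁₃ θ hP K₀ g₀ os hc hsat h20)

end Record

/-! ## §5  K3⁷ v3 shapes on the live-selector line: run A's mass is positive there (E1), so saturation is the bare fraction inequality -/

section Live

variable (K₀ : ℕ) (θ : Stage13HParams F N) (hP : θ.Provisos₁₃CoPH F N)

/-- **ON THE LIVE LINE RUN A's TOTAL KEYED CLASS MASS IS POSITIVE**, every `g₀`, `os`, `K`, `t`: E1 at the reading (dag-n20-d's `schemeZ_eq_sum_classSet_weightA` under the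
live-selector pin `hsel` and (H-U) ∕ (H-ζ); `0 ≤ ζ` from the provisos, dag-n20-w2's `zeta_nonneg_of_provisos₁₃CoPH`) + `schemeZ_pos_datumOfRecord₁₃CoPH`. [bookkeeping] -/
theorem sum_classSet₁₃_weightA₁₃_pos_of_liveSel
    (hsel : θ.ppSel = ppSelLiveOfRecord F N θ.ν θ.τ9 (EOfRecord₁₃ F N θ.toStage13Params) (wOfRecord₉ F N θ.toStage9Params))
    (hU : LocalBgMeasurable F N θ.ν) (hζm : ZetaMeasurable F N θ.ζ) (g₀ : ℕ → ℝ) (os : List (ULoop F)) (K : ℕ) (t : ℝ) :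
    0 < ∑ x ∈ classSet₁₃ θ K₀ g₀ K, weightA₁₃ θ hP K₀ g₀ os K t x := by
  rw [← schemeZ_eq_sum_classSet_weightA K₀ θ hP (EOfRecord₁₃ F N θ.toStage13Params) hsel hU hζm (zeta_nonneg_of_provisos₁₃CoPH F θ hP) g₀ os K t]
  exact schemeZ_pos_datumOfRecord₁₃CoPH θ hP g₀ os (K₀ + K) t

/-- ★★ **ON A LIVE TUPLE WHOSE FIRST-LEVEL FRACTION IS EVENTUALLY `≥ c > 0`, EVERY POLICY CARRYING THE N20 FACE AT `crOfRecord₁₃VAt K₀ jcut sh` IS EVENTUALLY ZERO** — the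
positivity clause of §4 discharged by E1. [bookkeeping] -/
theorem eventually_policy_eq_zero_of_relWeightBound_crOfRecord₁₃VAt_of_liveSel
    (hsel : θ.ppSel = ppSelLiveOfRecord F N θ.ν θ.τ9 (EOfRecord₁₃ F N θ.toStage13Params) (wOfRecord₉ F N θ.toStage9Params))
    (hU : LocalBgMeasurable F N θ.ν) (hζm : ZetaMeasurable F N θ.ζ) (g₀ : ℕ → ℝ) (os : List (ULoop F)) (jcut : ℕ → ℕ) (sh : ShellSplit₁₃CoPH N K₀)
    {c : ℝ} (hc : 0 < c)
    (hsat : ∀ᶠ K in atTop, ∃ t : ℝ, |t| ≤ 1 ∧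
      c * ∑ x ∈ classSet₁₃ θ K₀ g₀ K, weightA₁₃ θ hP K₀ g₀ os K t x ≤ ∑ x ∈ badClass₁₃ θ K₀ g₀ (fun _ => 1) K t, weightA₁₃ θ hP K₀ g₀ os K t x)
    (h : RelWeightBound (crOfRecord₁₃VAt K₀ jcut sh F θ hP g₀ os).l₀ (crOfRecord₁₃VAt K₀ jcut sh F θ hP g₀ os).T (crOfRecord₁₃VAt K₀ jcut sh F θ hP g₀ os).A
      (crOfRecord₁₃VAt K₀ jcut sh F θ hP g₀ os).B (crOfRecord₁₃VAt K₀ jcut sh F θ hP g₀ os).Bad (crOfRecord₁₃VAt K₀ jcut sh F θ hP g₀ os).W) :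
    ∀ᶠ K in atTop, jcut K = 0 :=
  eventually_policy_eq_zero_of_relWeightBound_carriers₁₃ θ hP K₀ g₀ os hc
    (hsat.mono fun K ⟨t, ht, hle⟩ => ⟨t, ht, sum_classSet₁₃_weightA₁₃_pos_of_liveSel K₀ θ hP hsel hU hζm g₀ os K t, hle⟩) h

end Live

section Stub

/-- ★★ **THE v3 SHAPE: ON A SATURATED LIVE TUPLE THE CUT READING OF ANY STUB-2 WITNESS IS EVENTUALLY ZERO.**  For a cut READING `jc` (K3⁷ v3's `CutReading`), a shell split
`sh` and a spine reading `cr : SpineReading₁₃CoPH 2` PINNED AT LIVE (`PinnedAtLive jc sh cr`, spelled out: on the live-selector line `cr … = crOfRecord₁₃V (jc …) sh …`), the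
`KeyedRelWeight cr` binder AT a live tuple with core provisos under (H-U) ∕ (H-ζ) whose first-level fraction of run A's mass is eventually `≥ c > 0` forces
`∀ᶠ K, jc F θ hP g₀ os K = 0` — at that tuple the witness policy excuses NO class cofinitely, and the `KeyedCoreEdgeHolderD4` conjunct is owed on every keyed class in the
limit (§3).  The guards `ZhUnity ∧ SlotsNondegenerate₁₃` and `Admissible` are not read. [bookkeeping] -/
theorem eventually_cut_eq_zero_of_keyedRelWeight_pinnedAtLive
    (jc : (F : T4Family) → (θ : Stage13HParams F 2) → θ.Provisos₁₃CoPH F 2 → (ℕ → ℝ) → List (ULoop F) → ℕ → ℕ) (sh : ShellSplit₁₃CoPH 2 0)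
    (cr : SpineReading₁₃CoPH 2)
    (hpin : ∀ (F : T4Family) (θ : Stage13HParams F 2) (hP : θ.Provisos₁₃CoPH F 2) (g₀ : ℕ → ℝ) (os : List (ULoop F)),
      θ.ppSel = ppSelLiveOfRecord F 2 θ.ν θ.τ9 (EOfRecord₁₃ F 2 θ.toStage13Params) (wOfRecord₉ F 2 θ.toStage9Params) →
        cr F θ hP g₀ os = crOfRecord₁₃V (jc F θ hP g₀ os) sh F θ hP g₀ os)
    {F : T4Family} (θ : Stage13HParams F 2) (hP : θ.Provisos₁₃CoPH F 2)
    (hsel : θ.ppSel = ppSelLiveOfRecord F 2 θ.ν θ.τ9 (EOfRecord₁₃ F 2 θ.toStage13Params) (wOfRecord₉ F 2 θ.toStage9Params))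
    (hU : LocalBgMeasurable F 2 θ.ν) (hζm : ZetaMeasurable F 2 θ.ζ) (g₀ : ℕ → ℝ) (os : List (ULoop F)) {c : ℝ} (hc : 0 < c)
    (hsat : ∀ᶠ K in atTop, ∃ t : ℝ, |t| ≤ 1 ∧
      c * ∑ x ∈ classSet₁₃ θ 0 g₀ K, weightA₁₃ θ hP 0 g₀ os K t x ≤ ∑ x ∈ badClass₁₃ θ 0 g₀ (fun _ => 1) K t, weightA₁₃ θ hP 0 g₀ os K t x)
    (h20 : RelWeightBound (cr F θ hP g₀ os).l₀ (cr F θ hP g₀ os).T (cr F θ hP g₀ os).A (cr F θ hP g₀ os).B (cr F θ hP g₀ os).Bad (cr F θ hP g₀ os).W) :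
    ∀ᶠ K in atTop, jc F θ hP g₀ os K = 0 := by
  rw [hpin F θ hP g₀ os hsel, crOfRecord₁₃V_eq] at h20
  exact eventually_policy_eq_zero_of_relWeightBound_crOfRecord₁₃VAt_of_liveSel 0 θ hP hsel hU hζm g₀ os (jc F θ hP g₀ os) sh hc hsat h20

end Stub

/-! ## §6  Converse bookkeeping: at an eventually-zero policy the N20 face is a finite-cutoff statement -/

section Finite

variable (θ : Stage13HParams F N) (hP : θ.Provisos₁₃CoPH F N) (K₀ : ℕ) (g₀ : ℕ → ℝ) (os : List (ULoop F))

/-- **AT A POLICY VANISHING FROM `K₁` ON, THE N20 FACE AT THE CARRIERS OF RECORD IS A STATEMENT ABOUT THE CUTOFFS `K < K₁` ONLY**: per-step relative bounds `w K ∈ [0, 1[`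
of the policy-`jcut` class in both runs for `K < K₁` give `RelWeightBound` with the FINITELY SUPPORTED witness `K ↦ if K < K₁ then w K else 0` — no summability content, no
estimate beyond the first `K₁` cutoffs (there the content is the bound `w K < 1`, i.e. the GOOD class keeps positive mass).  The mirror image of §2: what an admissible dial
CAN carry. [bookkeeping] -/
theorem relWeightBound_carriers₁₃_of_eventually_zero_policy {jcut : ℕ → ℕ} {K₁ : ℕ} (hz : ∀ K, K₁ ≤ K → jcut K = 0) {w : ℕ → ℝ}
    (hw0 : ∀ K, K < K₁ → 0 ≤ w K) (hw1 : ∀ K, K < K₁ → w K < 1)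
    (hA : ∀ K, K < K₁ → ∀ t : ℝ, |t| ≤ 1 →
      ∑ x ∈ badClass₁₃ θ K₀ g₀ jcut K t, weightA₁₃ θ hP K₀ g₀ os K t x ≤ w K * ∑ x ∈ classSet₁₃ θ K₀ g₀ K, weightA₁₃ θ hP K₀ g₀ os K t x)
    (hB : ∀ K, K < K₁ → ∀ t : ℝ, |t| ≤ 1 →
      ∑ x ∈ badClass₁₃ θ K₀ g₀ jcut K t, weightB₁₃ θ hP K₀ g₀ os K t x ≤ w K * ∑ x ∈ classSet₁₃ θ K₀ g₀ K, weightB₁₃ θ hP K₀ g₀ os K t x) :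
    RelWeightBound 1 (classSet₁₃ θ K₀ g₀) (weightA₁₃ θ hP K₀ g₀ os) (weightB₁₃ θ hP K₀ g₀ os) (badClass₁₃ θ K₀ g₀ jcut)
      (fun K => if K < K₁ then w K else 0) where
  bad_subset K t _ := badClass₁₃_subset θ K₀ g₀ jcut K t
  nonneg K := by split_ifs with hK; exacts [hw0 K hK, le_rfl]
  lt_one K := by split_ifs with hK; exacts [hw1 K hK, zero_lt_one]
  summable := by
    refine summable_of_hasFiniteSupport ((Set.finite_Iio K₁).subset fun K hK => ?_)
    by_contra hlt
    exact hK (if_neg hlt)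
  bad_left K t ht := by
    by_cases hK : K < K₁
    · simp only [hK, if_true]
      exact hA K hK t ht
    · rw [badClass₁₃_eq_empty_of_apply_eq_zero θ K₀ g₀ (hz K (not_lt.1 hK)) t, Finset.sum_empty]
      simp only [hK, if_false, zero_mul, le_refl]
  bad_right K t ht := by
    by_cases hK : K < K₁
    · simp only [hK, if_true]
      exact hB K hK t ht
    · rw [badClass₁₃_eq_empty_of_apply_eq_zero θ K₀ g₀ (hz K (not_lt.1 hK)) t, Finset.sum_empty]
      simp only [hK, if_false, zero_mul, le_refl]

end Finite

end Summit.QuantumFields.YangMills.BalabanUVNodes.N20KeyedRelWeightPolicyWall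

end
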